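import Summits.BirchSwinnertonDyer.BirchSwinnertonDyer.Theses.GoldfeldAllTwistsTwoConverse
import Summits.BirchSwinnertonDyer.BirchSwinnertonDyer.Theorems.GoldfeldGoodTwistsAllTwistsCells
import HarnessLib

set_option linter.dupNamespace false
set_option autoImplicit false

/-!
# Route `GoldfeldAllTwistsTwoConverse` — split-glue item 1 (K12₂′ from its cells), proved

Cell `bsd-goldfeld`, file 15. The route file `Theses/GoldfeldAllTwistsTwoConverse.lean` (rev 2, commit
60671b84767a) carries the two layer-2 glued splits of its cruxes: K12₂′ = `RankOneTwoConverseCMSevenAtAnyTwo`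
(item 19349) into the additive cell K12₂″ (item 20044) + BCST Thm A (item 20045) with glue item
`RankOneTwoConverseCMSevenAtAnyTwoOfCells` (item 20046), and the formula twin `BSDTwoCMSplitRankOne`
(item 19350) into twin″ (item 19140) + LTYZ Thm 1.1 (item 19141) with glue item `BSDTwoCMSplitRankOneOfCells`
(item 19142). This file PROVES the first glue item (type stated fully qualified, so the gate closes item 20046 by type
match); the proof delta-unfolds the route's defs to tree file 13's theorem
`rankOneTwoConverseCMSevenAtAnyTwo_of_additiveCell` (`GoldfeldGoodTwistsAllTwistsCells`, commit eac0f0ad8e10).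
The second glue item (19142) is proved in the sibling file `GoldfeldAllTwistsTwoConverseSplitGlueTwin.lean`.

References: A. Burungale, F. Castella, C. Skinner, Y. Tian, Ann. Math. Qué. 46 (2022), Thm. A and Rem. D
[BurungaleCastellaSkinnerTian2022]; Y.-X. Li, Y. Tian, X. Yan, X. Zhu, Pure Appl. Math. Q. 21 (2025) 1–54 (doi:10.4310/pamq.251115004959), Thm. 1.1 (ii)
and §1.3 [LiTianYanZhu2025].
-/

namespace Summit.BirchSwinnertonDyer.BirchSwinnertonDyer.Theorems.GoldfeldGoodTwists

/-- **Glue of split 1, proved**: K12₂″ → BCST Thm A → K12₂′ (file 13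
`rankOneTwoConverseCMSevenAtAnyTwo_of_additiveCell`). [cite: BurungaleCastellaSkinnerTian2022, Thm. A and Rem. D (p. 327)] -/
theorem rankOneTwoConverseCMSevenAtAnyTwo_of_cells :
    Summit.BirchSwinnertonDyer.BirchSwinnertonDyer.Theses.GoldfeldAllTwistsTwoConverse.RankOneTwoConverseCMSevenAtAnyTwoOfCells :=
  fun hXL hA => rankOneTwoConverseCMSevenAtAnyTwo_of_additiveCell hA hXL

end Summit.BirchSwinnertonDyer.BirchSwinnertonDyer.Theorems.GoldfeldGoodTwists
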